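import Literature.Geometry.Hyperkaehler.AutomorphismsLocalSystemFixedPoints
import Literature.Geometry.Kaehler.FibrePropertyConnectedBase
import HarnessLib

/-!
# Fixed points of `Aut°` along ONE family of irreducible symplectic manifolds: «every element of
# order `n` of `Aut°` has exactly `N` fixed points» holds for one fibre iff for any other (PROVED
# from Hassett–Tschinkel's local-system fact; steps (ii)+(iii) of the F125X synthesis for one family)

Layer `Literature/Geometry/Hyperkaehler`; sequel of `AutomorphismsLocalSystemFixedPoints.lean`
(`HassettTschinkel2013_holAutZero_localSystem.exists_nhds_ncard_fixedPoints_eq`: over the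
trivialising neighbourhood `U` of a fibre `X₀` the restriction isomorphisms `Aut°(X₀) ≅ Aut°(X_b)`
preserve the number of fixed points of finite-order elements with finite fixed set) and of
`Geometry/Kaehler/FibrePropertyConnectedBase.lean` (`fibreProp_iff_of_locally_iff`: a locally
constant fibre property is constant over a connected base).  Two statements:

* `HassettTschinkel2013_holAutZero_localSystem.exists_nhds_ncard_fixedPoints_eq₂` — the symmetric
  two-fibre form over `U`: for `b, b' ∈ U` and identifications `X ≅ 𝒳_b`, `X' ≅ 𝒳_{b'}`,
  isomorphisms `e : Aut°(X₀) ≃* Aut°(X)`, `e' : Aut°(X₀) ≃* Aut°(X')` with, for every finite-order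
  `g`: `Fix (e g)` finite ⟺ `Fix (e' g)` finite, and then `|Fix (e' g)| = |Fix (e g)|`;
* `HassettTschinkel2013_holAutZero_localSystem.forall_orderOf_ncard_fixedPoints_iff` — THE
  ONE-FAMILY STATEMENT: along a proper holomorphic submersion `π : 𝒳 → B` over a connected base all
  of whose fibres are irreducible symplectic (the hypotheses of the fact), for any two fibres
  `X ≅ 𝒳_s`, `Y ≅ 𝒳_t`, any `n ≥ 1` and `N`: every `g ∈ Aut°(X)` of order `n` has exactly `N` fixed
  points (a finite set) iff every `g ∈ Aut°(Y)` of order `n` does.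

This is the sentence "Since automorphisms in `Aut₀(K)` deform with `K`, their fixed loci deform as
well" (S. Floccari, Compositio Math. 160 (2024), proof of Lemma 2.2 [`Floccari2024`],
arXiv:2210.02948 p. 5 L35–L38; Hassett–Tschinkel, arXiv:1004.0046 p. 6 L124–L126: "thus the
fixed-point loci carry over as well" [`HassettTschinkel2013`]) for ONE family and the fixed-point
COUNT of finite-order elements — i.e. steps (ii)+(iii) of the print-synthesis record
`Literature.AlgebraicGeometry.Hyperkaehler.HassettTschinkel2013_Oguiso2020_fixedPointScheme_translation_kum4Type`
restricted to one family of the deformation chain (with `n = 5`, `N = 125` there).  What remains of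
that synthesis OUTSIDE this file: the induction over the chain (`IsDeformationEquivalent`; the
families of `IsDeformationOf` do not provide the every-fibre-irreducible-symplectic hypothesis of
the fact — the cell's recorded «IHS-chain» gap), the identification of the order-`5` elements of
`Aut°` with `Γ ∖ 1`, and the algebraic ends (GAGA for `Aut`, fixed-point scheme vs fixed-point set,
reducedness — `GroupActions/FixedPointSchemeSmoothHolds`).  Cross-ladder literature layer of ladder
HodgeAV, rung H3 (cell `hodge-kum4`, sub-home `lit-family`, tranche LT-H3 (a)+(b)+(c)).
Everything proved from the fact taken as hypothesis `h`; no definitions, no instances, no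
notation, NO new named fact; nothing here asserts HC / HC_Kum4Type.
-/

noncomputable section

open scoped Manifold ContDiff Topology
open Function Set Filter
open Literature.Geometry.Kaehler

universe u

namespace Literature.Geometry.Hyperkaehler

variable {E𝒳 : Type u} [NormedAddCommGroup E𝒳] [NormedSpace ℂ E𝒳] [FiniteDimensional ℂ E𝒳]
  {𝒳 : Type u} [TopologicalSpace 𝒳] [ChartedSpace E𝒳 𝒳] [IsManifold 𝓘(ℂ, E𝒳) ω 𝒳]
  [T2Space 𝒳] [SecondCountableTopology 𝒳]
  {EB : Type u} [NormedAddCommGroup EB] [NormedSpace ℂ EB] [FiniteDimensional ℂ EB]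
  {B : Type u} [TopologicalSpace B] [ChartedSpace EB B] [IsManifold 𝓘(ℂ, EB) ω B]
  [T2Space B] [SecondCountableTopology B] [ConnectedSpace B]
  {π : 𝒳 → B}

/-- **Two fibres over the trivialising neighbourhood** (symmetric form of
`exists_nhds_ncard_fixedPoints_eq`): for `b, b' ∈ U` and identifications `ι : X ≅ 𝒳_b`,
`ι' : X' ≅ 𝒳_{b'}` there are isomorphisms `e : Aut°(X₀) ≃* Aut°(X)`, `e' : Aut°(X₀) ≃* Aut°(X')` such
that for every `g ∈ Aut°(X₀)` of finite order, `Fix (e g)` is finite iff `Fix (e' g)` is, and then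
`|Fix (e' g)| = |Fix (e g)|`.
[cite: HassettTschinkel2013, §2 Thm. 2.1 and p. 6 («the fixed-point loci carry over»)]
[cite: Floccari2024, §2 Lemma 2.2 (proof: «their fixed loci deform as well»)] -/
theorem HassettTschinkel2013_holAutZero_localSystem.exists_nhds_ncard_fixedPoints_eq₂
    (h : HassettTschinkel2013_holAutZero_localSystem.{u})
    (hπ : IsProperHolomorphicSubmersion E𝒳 EB π)
    (hIHS : ∀ b : B, ∃ (X : ComplexManifold.{u}) (ι : X → 𝒳),
      IsFibreEmbedding X.model E𝒳 π b ι ∧ X.IsIrreducibleSymplectic)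
    (b₀ : B) (X₀ : ComplexManifold.{u}) (ι₀ : X₀ → 𝒳) (hι₀ : IsFibreEmbedding X₀.model E𝒳 π b₀ ι₀) :
    ∃ U : Set B, IsOpen U ∧ IsConnected U ∧ b₀ ∈ U ∧
      ∀ b ∈ U, ∀ (X : ComplexManifold.{u}) (ι : X → 𝒳), IsFibreEmbedding X.model E𝒳 π b ι →
        ∀ b' ∈ U, ∀ (X' : ComplexManifold.{u}) (ι' : X' → 𝒳), IsFibreEmbedding X'.model E𝒳 π b' ι' →
          ∃ (e : holAutZero X₀.model X₀ ≃* holAutZero X.model X)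
            (e' : holAutZero X₀.model X₀ ≃* holAutZero X'.model X'),
            ∀ g : holAutZero X₀.model X₀, IsOfFinOrder (g : X₀ ≃ₜ X₀) →
              ({x : X | ((e g : holAutZero X.model X) : X ≃ₜ X) x = x}.Finite ↔
                  {x' : X' | ((e' g : holAutZero X'.model X') : X' ≃ₜ X') x' = x'}.Finite) ∧
              ({x : X | ((e g : holAutZero X.model X) : X ≃ₜ X) x = x}.Finite →
                {x' : X' | ((e' g : holAutZero X'.model X') : X' ≃ₜ X') x' = x'}.ncard =
                  {x : X | ((e g : holAutZero X.model X) : X ≃ₜ X) x = x}.ncard) := by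
  obtain ⟨U, hUo, hUc, hb₀U, Φ, hsec, hmul, hone, hfib⟩ := h hπ hIHS b₀ X₀ ι₀ hι₀
  refine ⟨U, hUo, hUc, hb₀U, fun b hb X ι hι b' hb' X' ι' hι' => ?_⟩
  have hιS : ∀ x, ι x ∈ π ⁻¹' U := fun x => by
    show π (ι x) ∈ U
    rw [hι.apply_eq x]; exact hb
  have hι'S : ∀ x, ι' x ∈ π ⁻¹' U := fun x => by
    show π (ι' x) ∈ U
    rw [hι'.apply_eq x]; exact hb'
  obtain ⟨hres, huniq⟩ := hfib b hb X ι hι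
  obtain ⟨hres', huniq'⟩ := hfib b' hb' X' ι' hι'
  obtain ⟨e, he⟩ := exists_mulEquiv_of_restriction (holAutZero X₀.model X₀) (holAutZero X.model X)
    Φ ι hι.isClosedEmbedding.injective (π ⁻¹' U) hιS hmul hres huniq
  obtain ⟨e', he'⟩ := exists_mulEquiv_of_restriction (holAutZero X₀.model X₀)
    (holAutZero X'.model X') Φ ι' hι'.isClosedEmbedding.injective (π ⁻¹' U) hι'S hmul hres' huniq'
  have key : ∀ g : holAutZero X₀.model X₀, IsOfFinOrder (g : X₀ ≃ₜ X₀) →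
      {x : X | ((e g : holAutZero X.model X) : X ≃ₜ X) x = x}.Finite →
        {x' : X' | ((e' g : holAutZero X'.model X') : X' ≃ₜ X') x' = x'}.ncard =
            {x : X | ((e g : holAutZero X.model X) : X ≃ₜ X) x = x}.ncard ∧
          {x' : X' | ((e' g : holAutZero X'.model X') : X' ≃ₜ X') x' = x'}.Finite :=
    fun g hgo hfin =>
      ncard_fixedPoints_eq_of_restriction hπ hUo hUc.isPreconnected (holAutZero X₀.model X₀) Φ
        (fun g hg => (hsec g hg).1) (fun g hg => (hsec g hg).2.1) hmul hone g.2 hgo hb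
        hι.isClosedEmbedding.injective hι.range_eq ((e g : holAutZero X.model X) : X ≃ₜ X)
        (fun x => he g x) hb' hι'.isClosedEmbedding.injective hι'.range_eq
        ((e' g : holAutZero X'.model X') : X' ≃ₜ X') (fun x => he' g x) hfin
  have key' : ∀ g : holAutZero X₀.model X₀, IsOfFinOrder (g : X₀ ≃ₜ X₀) →
      {x' : X' | ((e' g : holAutZero X'.model X') : X' ≃ₜ X') x' = x'}.Finite →
        {x : X | ((e g : holAutZero X.model X) : X ≃ₜ X) x = x}.ncard =
            {x' : X' | ((e' g : holAutZero X'.model X') : X' ≃ₜ X') x' = x'}.ncard ∧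
          {x : X | ((e g : holAutZero X.model X) : X ≃ₜ X) x = x}.Finite :=
    fun g hgo hfin =>
      ncard_fixedPoints_eq_of_restriction hπ hUo hUc.isPreconnected (holAutZero X₀.model X₀) Φ
        (fun g hg => (hsec g hg).1) (fun g hg => (hsec g hg).2.1) hmul hone g.2 hgo hb'
        hι'.isClosedEmbedding.injective hι'.range_eq ((e' g : holAutZero X'.model X') : X' ≃ₜ X')
        (fun x => he' g x) hb hι.isClosedEmbedding.injective hι.range_eq
        ((e g : holAutZero X.model X) : X ≃ₜ X) (fun x => he g x) hfin
  refine ⟨e, e', fun g hgo => ⟨⟨fun hf => (key g hgo hf).2, fun hf => (key' g hgo hf).2⟩,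
    fun hf => (key g hgo hf).1⟩⟩

/-- **Along ONE family of irreducible symplectic manifolds, «every element of order `n` of `Aut°`
has exactly `N` fixed points» holds for one fibre iff it holds for any other** (Hassett–Tschinkel
Thm. 2.1 + the analytic fixed-locus package + the open-and-closed step
`Kaehler.fibreProp_iff_of_locally_iff`; PROVED from the fact).  This is steps (ii)+(iii) of the
print-synthesis behind F125X («`Aut°` deforms with `X`»; «fixed loci deform») for one family
`π : 𝒳 → B` over a connected base, all of whose fibres are irreducible symplectic: for fibres
`X ≅ 𝒳_s`, `Y ≅ 𝒳_t` and `n ≥ 1`, every `g ∈ Aut°(X)` of order `n` has exactly `N` fixed points (a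
finite set) iff every `g ∈ Aut°(Y)` of order `n` does.
[cite: HassettTschinkel2013, §2 Thm. 2.1 and p. 6 («the fixed-point loci carry over»)]
[cite: Floccari2024, §2 Lemma 2.2 (proof: «their fixed loci deform as well»)] -/
theorem HassettTschinkel2013_holAutZero_localSystem.forall_orderOf_ncard_fixedPoints_iff
    (h : HassettTschinkel2013_holAutZero_localSystem.{u})
    (hπ : IsProperHolomorphicSubmersion E𝒳 EB π)
    (hIHS : ∀ b : B, ∃ (X : ComplexManifold.{u}) (ι : X → 𝒳),
      IsFibreEmbedding X.model E𝒳 π b ι ∧ X.IsIrreducibleSymplectic)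
    {s t : B} {X Y : ComplexManifold.{u}} {ι : X → 𝒳} {κ : Y → 𝒳}
    (hι : IsFibreEmbedding X.model E𝒳 π s ι) (hκ : IsFibreEmbedding Y.model E𝒳 π t κ)
    {n : ℕ} (hn : 0 < n) (N : ℕ) :
    (∀ g : holAutZero X.model X, orderOf (g : X ≃ₜ X) = n →
        {x : X | (g : X ≃ₜ X) x = x}.ncard = N ∧ {x : X | (g : X ≃ₜ X) x = x}.Finite) ↔
      (∀ g : holAutZero Y.model Y, orderOf (g : Y ≃ₜ Y) = n →
        {y : Y | (g : Y ≃ₜ Y) y = y}.ncard = N ∧ {y : Y | (g : Y ≃ₜ Y) y = y}.Finite) := by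
  -- the property and its local constancy
  let P : ComplexManifold.{u} → Prop := fun Z => ∀ g : holAutZero Z.model Z,
    orderOf (g : Z ≃ₜ Z) = n → {z : Z | (g : Z ≃ₜ Z) z = z}.ncard = N ∧ {z : Z | (g : Z ≃ₜ Z) z = z}.Finite
  have hfib : ∀ b : B, ∃ (Z : ComplexManifold.{u}) (μ : Z → 𝒳), IsFibreEmbedding Z.model E𝒳 π b μ :=
    fun b => by
      obtain ⟨Z, μ, hμ, -⟩ := hIHS b
      exact ⟨Z, μ, hμ⟩
  have hloc : ∀ (b₀ : B) (X₀ : ComplexManifold.{u}) (ι₀ : X₀ → 𝒳),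
      IsFibreEmbedding X₀.model E𝒳 π b₀ ι₀ →
        ∃ U : Set B, IsOpen U ∧ b₀ ∈ U ∧
          ∀ b ∈ U, ∀ (Z : ComplexManifold.{u}) (μ : Z → 𝒳),
            IsFibreEmbedding Z.model E𝒳 π b μ → (P Z ↔ P X₀) := by
    intro b₀ X₀ ι₀ hι₀
    obtain ⟨U, hUo, -, hb₀U, hU⟩ := h.exists_nhds_ncard_fixedPoints_eq₂ hπ hIHS b₀ X₀ ι₀ hι₀
    refine ⟨U, hUo, hb₀U, fun b hb Z μ hμ => ?_⟩
    obtain ⟨e, e', hee'⟩ := hU b hb Z μ hμ b₀ hb₀U X₀ ι₀ hι₀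
    constructor
    · -- `P Z → P X₀`
      intro hZ g₀ hg₀
      set g : holAutZero X₀.model X₀ := e'.symm g₀ with hgdef
      have hg₀' : e' g = g₀ := e'.apply_symm_apply g₀
      have hord : orderOf (g : X₀ ≃ₜ X₀) = n := by
        rw [Subgroup.orderOf_coe, hgdef, MulEquiv.orderOf_eq, ← Subgroup.orderOf_coe, hg₀]
      have hgo : IsOfFinOrder (g : X₀ ≃ₜ X₀) := orderOf_pos_iff.1 (hord ▸ hn)
      have hordZ : orderOf ((e g : holAutZero Z.model Z) : Z ≃ₜ Z) = n := by
        rw [Subgroup.orderOf_coe, MulEquiv.orderOf_eq, ← Subgroup.orderOf_coe, hord]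
      obtain ⟨hN, hfinZ⟩ := hZ (e g) hordZ
      obtain ⟨hiff, hcount⟩ := hee' g hgo
      have hcount' := hcount hfinZ
      rw [hg₀'] at hiff hcount'
      exact ⟨hcount'.trans hN, hiff.1 hfinZ⟩
    · -- `P X₀ → P Z`
      intro hX₀ g' hg'
      set g : holAutZero X₀.model X₀ := e.symm g' with hgdef
      have hg'' : e g = g' := e.apply_symm_apply g'
      have hord : orderOf (g : X₀ ≃ₜ X₀) = n := by
        rw [Subgroup.orderOf_coe, hgdef, MulEquiv.orderOf_eq, ← Subgroup.orderOf_coe, hg']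
      have hgo : IsOfFinOrder (g : X₀ ≃ₜ X₀) := orderOf_pos_iff.1 (hord ▸ hn)
      have hord' : orderOf ((e' g : holAutZero X₀.model X₀) : X₀ ≃ₜ X₀) = n := by
        rw [Subgroup.orderOf_coe, MulEquiv.orderOf_eq, ← Subgroup.orderOf_coe, hord]
      obtain ⟨hN, hfin'⟩ := hX₀ (e' g) hord'
      obtain ⟨hiff, hcount⟩ := hee' g hgo
      have hfinZ := hiff.2 hfin'
      have hcount' := hcount hfinZ
      rw [hg''] at hfinZ hcount'
      exact ⟨hcount'.symm.trans hN, hfinZ⟩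
  exact fibreProp_iff_of_locally_iff hfib P hloc hι hκ


/-- **Chain-step form** (the data of `Geometry.Kaehler.IsDeformationOf X Y`, Kodaira Def. 2.9,
TOGETHER WITH an irreducible symplectic fibre identification at every point of the base — the
hypothesis of Hassett–Tschinkel's theorem; dropping that last conjunct gives literally
`IsDeformationOf X Y`): if `Y` is a deformation of `X` through a family of irreducible symplectic
manifolds, then for `n ≥ 1` and `N`, every `g ∈ Aut°(X)` of order `n` has exactly `N` fixed points (a
finite set) iff every `g ∈ Aut°(Y)` of order `n` does.  This is the step of the chain induction
behind F125X that the tree's `IsDeformationEquivalent` (chains of `IsDeformationOf`, arbitrary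
compact complex fibres in between) does NOT supply: the every-fibre-irreducible-symplectic conjunct
is the cell's recorded «IHS-chain» hypothesis.
[cite: HassettTschinkel2013, §2 Thm. 2.1 and p. 6 («the fixed-point loci carry over»)]
[cite: Kodaira2005, §2.3 Def. 2.9] -/
theorem HassettTschinkel2013_holAutZero_localSystem.forall_orderOf_ncard_fixedPoints_iff_of_family
    (h : HassettTschinkel2013_holAutZero_localSystem.{u}) {X Y : ComplexManifold.{u}}
    (hXY : ∃ (𝒴 C : ComplexManifold.{u}) (ϖ : 𝒴 → C) (s t : C) (ι : X → 𝒴) (κ : Y → 𝒴),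
      T2Space 𝒴 ∧ SecondCountableTopology 𝒴 ∧ T2Space C ∧ SecondCountableTopology C ∧
        ConnectedSpace C ∧ IsProperHolomorphicSubmersion 𝒴.model C.model ϖ ∧
        IsFibreEmbedding X.model 𝒴.model ϖ s ι ∧ IsFibreEmbedding Y.model 𝒴.model ϖ t κ ∧
        ∀ c : C, ∃ (Z : ComplexManifold.{u}) (μ : Z → 𝒴),
          IsFibreEmbedding Z.model 𝒴.model ϖ c μ ∧ Z.IsIrreducibleSymplectic)
    {n : ℕ} (hn : 0 < n) (N : ℕ) :
    (∀ g : holAutZero X.model X, orderOf (g : X ≃ₜ X) = n →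
        {x : X | (g : X ≃ₜ X) x = x}.ncard = N ∧ {x : X | (g : X ≃ₜ X) x = x}.Finite) ↔
      (∀ g : holAutZero Y.model Y, orderOf (g : Y ≃ₜ Y) = n →
        {y : Y | (g : Y ≃ₜ Y) y = y}.ncard = N ∧ {y : Y | (g : Y ≃ₜ Y) y = y}.Finite) := by
  obtain ⟨𝒴, C, ϖ, s, t, ι, κ, h𝒴T2, h𝒴SC, hCT2, hCSC, hCconn, hϖ, hι, hκ, hIHS⟩ := hXY
  haveI := h𝒴T2; haveI := h𝒴SC; haveI := hCT2; haveI := hCSC; haveI := hCconn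
  exact h.forall_orderOf_ncard_fixedPoints_iff hϖ hIHS hι hκ hn N

/-- The hypothesis of the chain-step form implies `IsDeformationOf X Y` (it IS that datum plus the
every-fibre-irreducible-symplectic conjunct). [cite: Kodaira2005, §2.3 Def. 2.9] -/
theorem isDeformationOf_of_family_irreducibleSymplectic {X Y : ComplexManifold.{u}}
    (hXY : ∃ (𝒴 C : ComplexManifold.{u}) (ϖ : 𝒴 → C) (s t : C) (ι : X → 𝒴) (κ : Y → 𝒴),
      T2Space 𝒴 ∧ SecondCountableTopology 𝒴 ∧ T2Space C ∧ SecondCountableTopology C ∧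
        ConnectedSpace C ∧ IsProperHolomorphicSubmersion 𝒴.model C.model ϖ ∧
        IsFibreEmbedding X.model 𝒴.model ϖ s ι ∧ IsFibreEmbedding Y.model 𝒴.model ϖ t κ ∧
        ∀ c : C, ∃ (Z : ComplexManifold.{u}) (μ : Z → 𝒴),
          IsFibreEmbedding Z.model 𝒴.model ϖ c μ ∧ Z.IsIrreducibleSymplectic) :
    IsDeformationOf X Y := by
  obtain ⟨𝒴, C, ϖ, s, t, ι, κ, h1, h2, h3, h4, h5, h6, h7, h8, -⟩ := hXY
  exact ⟨𝒴, C, ϖ, s, t, ι, κ, h1, h2, h3, h4, h5, h6, h7, h8⟩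

end Literature.Geometry.Hyperkaehler

end
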